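import Summits.ResolutionOfSingularities.ResolutionOfSingularities.Theorems.EquisingularLiftEquisingularLiftNatDirectionAdaptedFrame
import HarnessLib

/-!
# [OURS · L1 W4.5(b) · EL♮(3) · S6 (L) brick C2, bridge piece X1 — preparation] Adapted affine frames from PRESCRIBED sections, and the
# invertibility of the matrix between two generating pairs

Crux chain w45b (cell `res-hironaka`), child EL♮(3) = stmt-ResolutionOfSingularities-20148; S6 (L) brick C2, bridge piece X1
`exists_dictAdaptedFrame` (res-type-027 g15's cut `Bridge-pieces.sig.lean` d74e4ef5f55702f7; desk DEAL 2026-08-28T00:36:58Z). Two inputs: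
* `exists_affine_adaptedFrame_of_germs` — B1′ (`exists_affine_adaptedFrame`, p586914) generalised to PRESCRIBED sections `g₀, g₁` on an affine
  `V ∋ z` whose germs at `z` generate `Ī_z` with `𝒟'_z = (g₀)_z + Ī_z²`: an affine `W ⊆ V ∩ O` around `z` with `Ī(W) = (g|_W)`, `g|_W` quasi-regular
  in `Γ(G₀, W)`, `𝒟'(W) = (g₀|_W) + Ī(W)²` (same proof: chart models, `exists_nhd_forall_stalkIdeal_le`, `isQuasiRegular_of_isLocalization_maximal`
  + `IsQuasiRegular.of_span_pair_eq` at the closed points; no quasi-regularity of the prescribed germs is needed — it comes from the socket);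
* `isUnit_det_of_span_pair_eq_matrix` — in a local ring, if `c = M c'` entrywise, `(c) = (c') ⊆ 𝔪` and `c'` is a quasi-regular pair, then `det M`
  is a unit (the first half of `IsQuasiRegular.of_span_pair_eq`, p586453, exported).
Written by res-L1-w45b-stub-3 g7. OURS; NOT a statement of any manuscript; AI-written, weaker than expert review. No `sorry`; standard
axioms; DEF-FREE. `--supports stmt-ResolutionOfSingularities-20148 --as helper`. [cite: Matsumura1987, §16] [cite: Hartshorne1977, Ch. II Prop. 5.4]
(index only).
-/

set_option linter.dupNamespace false -- mandated namespace `Summit.<Summit>.<Problem>` of this single-conjunct summit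

noncomputable section

open CategoryTheory AlgebraicGeometry TopologicalSpace IsLocalRing
open Literature.AlgebraicGeometry.Resolution
open Literature.AlgebraicGeometry.Hironaka2017.S02Preliminaries
open AlgebraicGeometry.Scheme.IdealSheafData

namespace Summit.ResolutionOfSingularities.ResolutionOfSingularities.Cruxes.EquisingularLiftNat.Sections

universe u

/-- **Adapted affine frames from prescribed sections.** See the module docstring. [OURS · L1 W4.5b · S6 (L) C2, X1 prep] -/
theorem exists_affine_adaptedFrame_of_germs {G₀ : Scheme.{0}} [IsLocallyNoetherian G₀] (Ī 𝒟' : G₀.IdealSheafData)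
    (hdir' : ∀ z ∈ Ī.support, ∃ c : Fin 2 → G₀.presheaf.stalk z,
      Ideal.span (Set.range c) = stalkIdeal Ī z ∧ IsQuasiRegular c ∧
      stalkIdeal 𝒟' z = Ideal.span {c 0} ⊔ Ideal.span {c 1 * c 1})
    (z : G₀) (V : G₀.affineOpens) (hzV : z ∈ (V : G₀.Opens)) (g : Fin 2 → Γ(G₀, (V : G₀.Opens)))
    (hgspan : Ideal.span (Set.range fun j => (G₀.presheaf.germ (V : G₀.Opens) z hzV).hom (g j)) = stalkIdeal Ī z)
    (hg𝒟 : stalkIdeal 𝒟' z = Ideal.span {(G₀.presheaf.germ (V : G₀.Opens) z hzV).hom (g 0)} ⊔ stalkIdeal Ī z ^ 2)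
    (O : G₀.Opens) (hzO : z ∈ O) :
    ∃ (W : G₀.affineOpens) (_ : z ∈ (W : G₀.Opens)) (hWV : (W : G₀.Opens) ≤ V) (_ : (W : G₀.Opens) ≤ O),
      Ideal.span (Set.range fun j => G₀.presheaf.map (homOfLE hWV).op (g j)) = Ī.ideal W ∧
      IsQuasiRegular (fun j => G₀.presheaf.map (homOfLE hWV).op (g j)) ∧
      𝒟'.ideal W = Ideal.span {G₀.presheaf.map (homOfLE hWV).op (g 0)} ⊔ (Ī.ideal W) ^ 2 := by
  classical
  -- the chart models and their stalks
  set N := (Hironaka2005.idealSheafOnOpen V (Ideal.span (Set.range g))).map (V : G₀.Opens).ι with hNdef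
  set M := (Hironaka2005.idealSheafOnOpen V (Ideal.span {g 0} ⊔ Ī.ideal V ^ 2)).map (V : G₀.Opens).ι with hMdef
  have hN : ∀ (y : G₀) (hy : y ∈ (V : G₀.Opens)),
      stalkIdeal N y = Ideal.span (Set.range fun j => (G₀.presheaf.germ (V : G₀.Opens) y hy).hom (g j)) := by
    intro y hy
    rw [hNdef, stalkIdeal_map_idealSheafOnOpen V _ hy, Ideal.map_span, ← Set.range_comp]
    rfl
  have hM : ∀ (y : G₀) (hy : y ∈ (V : G₀.Opens)),
      stalkIdeal M y = Ideal.span {(G₀.presheaf.germ (V : G₀.Opens) y hy).hom (g 0)} ⊔ stalkIdeal Ī y ^ 2 :=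
    fun y hy => stalkIdeal_chartModel_family Ī (fun _ : Unit => V) (fun _ => g 0) () hy
  have hNz : stalkIdeal N z = stalkIdeal Ī z := by rw [hN z hzV, hgspan]
  have hMz : stalkIdeal M z = stalkIdeal 𝒟' z := by rw [hM z hzV, hg𝒟]
  -- spread the two stalk equalities to a neighbourhood, and pick an affine `W` inside it
  obtain ⟨O₁, hzO₁, hO₁⟩ := exists_nhd_forall_stalkIdeal_le hNz.le
  obtain ⟨O₂, hzO₂, hO₂⟩ := exists_nhd_forall_stalkIdeal_le hNz.ge
  obtain ⟨O₃, hzO₃, hO₃⟩ := exists_nhd_forall_stalkIdeal_le hMz.le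
  obtain ⟨O₄, hzO₄, hO₄⟩ := exists_nhd_forall_stalkIdeal_le hMz.ge
  obtain ⟨W', hW', hzW, hWle⟩ := exists_isAffineOpen_mem_and_subset (X := G₀) (x := z)
    (U := ((V : G₀.Opens) ⊓ O) ⊓ (O₁ ⊓ O₂) ⊓ (O₃ ⊓ O₄)) ⟨⟨⟨hzV, hzO⟩, hzO₁, hzO₂⟩, hzO₃, hzO₄⟩
  let W : G₀.affineOpens := ⟨W', hW'⟩
  have hWV : (W : G₀.Opens) ≤ V := fun p hp => (hWle hp).1.1.1
  have hWO : (W : G₀.Opens) ≤ O := fun p hp => (hWle hp).1.1.2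
  have hWO₁ : (W : G₀.Opens) ≤ O₁ := fun p hp => (hWle hp).1.2.1
  have hWO₂ : (W : G₀.Opens) ≤ O₂ := fun p hp => (hWle hp).1.2.2
  have hWO₃ : (W : G₀.Opens) ≤ O₃ := fun p hp => (hWle hp).2.1
  have hWO₄ : (W : G₀.Opens) ≤ O₄ := fun p hp => (hWle hp).2.2
  let gW : Fin 2 → Γ(G₀, (W : G₀.Opens)) := fun j => G₀.presheaf.map (homOfLE hWV).op (g j)
  have hgerm : ∀ (y : G₀) (hy : y ∈ (W : G₀.Opens)) (j : Fin 2),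
      (G₀.presheaf.germ (W : G₀.Opens) y hy).hom (gW j) = (G₀.presheaf.germ (V : G₀.Opens) y (hWV hy)).hom (g j) :=
    fun y hy j => TopCat.Presheaf.germ_res_apply G₀.presheaf (homOfLE hWV) y hy (g j)
  have hĪy : ∀ (y : G₀) (hy : y ∈ (W : G₀.Opens)),
      stalkIdeal Ī y = Ideal.span (Set.range fun j => (G₀.presheaf.germ (W : G₀.Opens) y hy).hom (gW j)) := by
    intro y hy
    rw [le_antisymm (hO₂ y (hWO₂ hy)) (hO₁ y (hWO₁ hy)), hN y (hWV hy)]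
    simp_rw [hgerm y hy]
  have h𝒟y : ∀ (y : G₀) (hy : y ∈ (W : G₀.Opens)),
      stalkIdeal 𝒟' y = Ideal.span {(G₀.presheaf.germ (W : G₀.Opens) y hy).hom (gW 0)} ⊔ stalkIdeal Ī y ^ 2 := by
    intro y hy
    rw [le_antisymm (hO₄ y (hWO₄ hy)) (hO₃ y (hWO₃ hy)), hM y (hWV hy), hgerm y hy]
  -- the two ideal equalities on `W`
  have hIW : Ī.ideal W = Ideal.span (Set.range gW) := by
    have hNW : ∀ (y : G₀) (hy : y ∈ (W : G₀.Opens)), stalkIdeal Ī y =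
        stalkIdeal ((Hironaka2005.idealSheafOnOpen W (Ideal.span (Set.range gW))).map (W : G₀.Opens).ι) y := by
      intro y hy
      rw [hĪy y hy, stalkIdeal_map_idealSheafOnOpen W _ hy, Ideal.map_span, ← Set.range_comp]
      rfl
    rw [ideal_eq_of_forall_stalkIdeal_eq_on Ī _ W hNW, ideal_map_idealSheafOnOpen]
  have h𝒟W : 𝒟'.ideal W = Ideal.span {gW 0} ⊔ (Ī.ideal W) ^ 2 := by
    have hMW : ∀ (y : G₀) (hy : y ∈ (W : G₀.Opens)), stalkIdeal 𝒟' y =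
        stalkIdeal ((Hironaka2005.idealSheafOnOpen W (Ideal.span {gW 0} ⊔ Ī.ideal W ^ 2)).map (W : G₀.Opens).ι) y := by
      intro y hy
      rw [h𝒟y y hy, stalkIdeal_chartModel_family Ī (fun _ : Unit => W) (fun _ => gW 0) () hy]
    rw [ideal_eq_of_forall_stalkIdeal_eq_on 𝒟' _ W hMW, ideal_map_idealSheafOnOpen]
  -- quasi-regularity of `gW` in `Γ(G₀, W)`: local at the closed points of `W`
  have hfrom : ∀ (P : Ideal Γ(G₀, (W : G₀.Opens))) [P.IsPrime], W.2.fromSpec.base ⟨P, inferInstance⟩ ∈ (W : G₀.Opens) :=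
    fun P _ => W.2.range_fromSpec.le ⟨_, rfl⟩
  have hqr : IsQuasiRegular gW := by
    refine Summit.ResolutionOfSingularities.ResolutionOfSingularities.Theorems.isQuasiRegular_of_isLocalization_maximal gW
      (fun P _ => G₀.presheaf.stalk (W.2.fromSpec.base ⟨P, inferInstance⟩)) (fun P _ => inferInstance)
      (fun P _ => (G₀.presheaf.germ (W : G₀.Opens) _ (hfrom P)).hom.toAlgebra)
      (fun P _ => W.2.isLocalization_stalk' ⟨P, inferInstance⟩ (hfrom P)) ?_
    intro P hP hle
    set y : G₀ := W.2.fromSpec.base ⟨P, hP.isPrime⟩ with hydef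
    have hy : y ∈ (W : G₀.Opens) := hfrom P
    letI : Algebra Γ(G₀, (W : G₀.Opens)) (G₀.presheaf.stalk y) := (G₀.presheaf.germ (W : G₀.Opens) y hy).hom.toAlgebra
    haveI : IsLocalization.AtPrime (G₀.presheaf.stalk y) P := W.2.isLocalization_stalk' ⟨P, hP.isPrime⟩ hy
    -- `Ī_y = (germ gW) ⊆ 𝔪_y`, so `y ∈ supp Ī`
    have hspan_y : Ideal.span (Set.range (algebraMap Γ(G₀, (W : G₀.Opens)) (G₀.presheaf.stalk y) ∘ gW)) = stalkIdeal Ī y := by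
      rw [hĪy y hy]; rfl
    have hle_y : stalkIdeal Ī y ≤ maximalIdeal _ := by
      rw [← hspan_y, Ideal.span_le]
      rintro _ ⟨j, rfl⟩
      exact (IsLocalization.AtPrime.to_map_mem_maximal_iff (G₀.presheaf.stalk y) P (gW j)).mpr
        (hle (Ideal.subset_span ⟨j, rfl⟩))
    have hyS : y ∈ Ī.support := (mem_support_iff_stalkIdeal_le Ī y).mpr hle_y
    obtain ⟨c', hc'span, hc'qr, -⟩ := hdir' y hyS
    exact IsQuasiRegular.of_span_pair_eq hc'qr (hc'span ▸ hle_y) (hspan_y.trans hc'span.symm)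
  exact ⟨W, hzW, hWV, hWO, hIW.symm, hqr, h𝒟W⟩

open MvPolynomial in
/-- **The matrix between two generating pairs is invertible** (local ring, one pair quasi-regular, the ideal inside `𝔪`). [OURS] -/
theorem isUnit_det_of_span_pair_eq_matrix {R : Type u} [CommRing R] [IsLocalRing R] {c c' : Fin 2 → R} (hc' : IsQuasiRegular c')
    (hle : Ideal.span (Set.range c') ≤ maximalIdeal R) (h : Ideal.span (Set.range c) = Ideal.span (Set.range c'))
    (M : Matrix (Fin 2) (Fin 2) R) (hm : ∀ i, ∑ j, M i j * c' j = c i) : IsUnit M.det := by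
  classical
  have hcN : ∀ j, ∃ n : Fin 2 → R, ∑ i, n i * c i = c' j := fun j =>
    Ideal.mem_span_range_iff_exists_fun.mp (h.symm ▸ Ideal.subset_span ⟨j, rfl⟩)
  choose n hn using hcN
  let N : Matrix (Fin 2) (Fin 2) R := Matrix.of fun j i => n j i
  -- `N M ≡ 1 (mod J)` by quasi-regularity in degree one
  have hNM : ∀ k j, (N * M) k j - (1 : Matrix (Fin 2) (Fin 2) R) k j ∈ Ideal.span (Set.range c') := by
    intro k j
    have hF := (isQuasiRegular_def c').mp hc' 1 (∑ j', C ((N * M - 1) k j') * X j') (isHomogeneous_linearForm _) ?_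
      (Finsupp.single j 1)
    · rw [coeff_linearForm] at hF
      simpa only [Matrix.sub_apply] using hF
    · -- the form vanishes at `c'`
      have h0 : eval c' (∑ j', C ((N * M - 1) k j') * X j' : MvPolynomial (Fin 2) R) = 0 := by
        rw [eval_linearForm]
        simp only [Matrix.sub_apply, sub_mul, Finset.sum_sub_distrib, Matrix.one_apply, ite_mul, one_mul, zero_mul,
          Finset.sum_ite_eq, Finset.mem_univ, if_true]
        rw [sub_eq_zero]
        calc ∑ j', (N * M) k j' * c' j' = ∑ j', ∑ i, N k i * M i j' * c' j' := by
              refine Finset.sum_congr rfl fun j' _ => ?_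
              rw [Matrix.mul_apply, Finset.sum_mul]
          _ = ∑ i, N k i * ∑ j', M i j' * c' j' := by
              rw [Finset.sum_comm]
              refine Finset.sum_congr rfl fun i _ => ?_
              rw [Finset.mul_sum]
              refine Finset.sum_congr rfl fun j' _ => ?_
              ring
          _ = ∑ i, n k i * c i := by
              refine Finset.sum_congr rfl fun i _ => ?_
              change n k i * ∑ j', M i j' * c' j' = _
              rw [hm i]
          _ = c' k := hn k
      rw [h0]
      exact Ideal.zero_mem _
  -- hence `det M` is a unit (`N M = 1` in the residue field)
  have hdet : IsUnit M.det := by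
    by_contra hnu
    have hmem : M.det ∈ maximalIdeal R := (mem_maximalIdeal _).mpr hnu
    let π : R →+* ResidueField R := residue R
    have h1 : (N * M).map π = (1 : Matrix (Fin 2) (Fin 2) R).map π := by
      ext k j
      simp only [Matrix.map_apply]
      rw [← sub_eq_zero, ← map_sub, residue_eq_zero_iff]
      exact hle (hNM k j)
    rw [Matrix.map_mul, Matrix.map_one π (map_zero π) (map_one π)] at h1
    have h2 : IsUnit (M.map π).det := by
      have h := congrArg Matrix.det h1
      rw [Matrix.det_mul, Matrix.det_one] at h
      exact IsUnit.of_mul_eq_one_right _ h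
    have h3 : π M.det = (M.map π).det := RingHom.map_det π M
    have h4 : π M.det = 0 := (residue_eq_zero_iff _).mpr hmem
    rw [h3] at h4
    rw [h4] at h2
    exact not_isUnit_zero h2
  exact hdet

end Summit.ResolutionOfSingularities.ResolutionOfSingularities.Cruxes.EquisingularLiftNat.Sections

end
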